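import Mathlib.LinearAlgebra.BilinearForm.TensorProduct
import Mathlib.LinearAlgebra.BilinearForm.Properties
import Mathlib.RingTheory.TensorProduct.Free
import HarnessLib

/-!
# A non-degenerate bilinear form stays non-degenerate under base change to ANY commutative algebra

Topic `LinearAlgebra/BaseChange`; theorems only (no definition, no named fact).

[Varadarajan1984, §3.9, proof of Cor. 3.9.4]: *"The relation (3.9.17)* [`det(⟨X_i, X_j⟩) ≠ 0`] *is the criterion for
`⟨·,·⟩` to be nonsingular"* — whence non-singularity of a bilinear form on a finite-dimensional `k`-space `V` is
unchanged by extension of scalars.  `Algebra/Lie/KillingBaseChange.nondegenerate_baseChange` proves this for a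
field extension `k′/k`; the same coordinate computation (test `x = Σ x_i (1 ⊗ b_i)` against `1 ⊗ d_j`, `d` the
`B`-dual basis, to read off `x_j = 0`) works for base change to an ARBITRARY commutative `k`-algebra `A`
(`nondegenerate_baseChange_algebra`): `B.baseChange A` is left- and right-separating on `A ⊗_k V`.  The case needed
by the adelic Weil representation is `A = F ⊗_ℚ ℝ = ∏_{σ∣∞} F_σ` resp. `A = 𝐀_F` acting on `W_𝐀 = 𝐀 ⊗_F W`
([GelbartRogawski1991, §3.1 p. 454 L17–22]: the symplectic space `(W_𝐀, φ_𝐀)`), where `A` is a product of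
fields, not a field.

## References

* V. S. Varadarajan, *Lie Groups, Lie Algebras, and Their Representations*, GTM 102 (1984), §3.9, Cor. 3.9.4 and
  (3.9.17). [Varadarajan1984]
-/

noncomputable section

open scoped TensorProduct

namespace Literature.LinearAlgebra.BaseChange

open LinearMap (BilinForm)

variable {k : Type*} [Field k] {A : Type*} [CommRing A] [Algebra k A]
variable {V : Type*} [AddCommGroup V] [Module k V]

/-- coordinates against a `k`-basis: `Bᴬ(x, 1 ⊗ v) = Σ_i x_i · B(b_i, v)`, `x = Σ_i x_i (1 ⊗ b_i)`. [folklore] -/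
private theorem baseChange_apply_one_tmul {ι : Type*} [Fintype ι] (b : Module.Basis ι k V) (B : BilinForm k V)
    (x : A ⊗[k] V) (v : V) :
    B.baseChange A x (1 ⊗ₜ v) =
      ∑ i, (Algebra.TensorProduct.basis A b).repr x i * algebraMap k A (B (b i) v) := by
  set bA := Algebra.TensorProduct.basis A b with hbA
  conv_lhs => rw [← bA.sum_repr x]
  rw [LinearMap.map_sum₂]
  refine Finset.sum_congr rfl fun i _ => ?_
  rw [LinearMap.map_smul₂, hbA, Algebra.TensorProduct.basis_apply, LinearMap.BilinForm.baseChange_tmul,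
    mul_one, smul_eq_mul, Algebra.smul_def, mul_one]

/-- coordinates against a `k`-basis, second slot: `Bᴬ(1 ⊗ v, x) = Σ_i x_i · B(v, b_i)`. [folklore] -/
private theorem baseChange_apply_one_tmul_left {ι : Type*} [Fintype ι] (b : Module.Basis ι k V)
    (B : BilinForm k V) (x : A ⊗[k] V) (v : V) :
    B.baseChange A (1 ⊗ₜ v) x =
      ∑ i, (Algebra.TensorProduct.basis A b).repr x i * algebraMap k A (B v (b i)) := by
  set bA := Algebra.TensorProduct.basis A b with hbA
  conv_lhs => rw [← bA.sum_repr x]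
  rw [map_sum]
  refine Finset.sum_congr rfl fun i _ => ?_
  rw [map_smul, hbA, Algebra.TensorProduct.basis_apply, LinearMap.BilinForm.baseChange_tmul,
    mul_one, smul_eq_mul, Algebra.smul_def, mul_one]

/-- a left-separating form with a right dual family stays left-separating after base change. [folklore] -/
private theorem separatingLeft_baseChange_of_dual {ι : Type*} [Fintype ι] [DecidableEq ι]
    (b : Module.Basis ι k V) (B : BilinForm k V) (d : ι → V)
    (hd : ∀ i j, B (b j) (d i) = if j = i then 1 else 0) :
    (B.baseChange A).SeparatingLeft := by
  intro x hx
  set bA := Algebra.TensorProduct.basis A b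
  refine bA.ext_elem fun i => ?_
  rw [map_zero, Finsupp.zero_apply]
  have h := hx (1 ⊗ₜ d i)
  rw [baseChange_apply_one_tmul b] at h
  simpa [hd i, Finset.sum_ite_eq', apply_ite (algebraMap k A)] using h

/-- a right-separating form with a left dual family stays right-separating after base change. [folklore] -/
private theorem separatingRight_baseChange_of_dual {ι : Type*} [Fintype ι] [DecidableEq ι]
    (b : Module.Basis ι k V) (B : BilinForm k V) (d : ι → V)
    (hd : ∀ i j, B (d i) (b j) = if j = i then 1 else 0) :
    (B.baseChange A).SeparatingRight := by
  intro x hx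
  set bA := Algebra.TensorProduct.basis A b
  refine bA.ext_elem fun i => ?_
  rw [map_zero, Finsupp.zero_apply]
  have h := hx (1 ⊗ₜ d i)
  rw [baseChange_apply_one_tmul_left b] at h
  simpa [hd i, Finset.sum_ite_eq', apply_ite (algebraMap k A)] using h

variable [FiniteDimensional k V]

/-- **Non-degeneracy survives base change to any commutative algebra**: if `B` is a non-degenerate bilinear form
on a finite-dimensional `k`-vector space `V` and `A` is a commutative `k`-algebra, then `B.baseChange A` is
non-degenerate (left- and right-separating) on `A ⊗_k V` — test against the `B`-dual basis
(`LinearMap.BilinForm.dualBasis`), as in the criterion (3.9.17). [cite: Varadarajan1984, §3.9 Cor. 3.9.4 (3.9.17)] -/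
theorem nondegenerate_baseChange_algebra {B : BilinForm k V} (hB : B.Nondegenerate) :
    (B.baseChange A).Nondegenerate := by
  classical
  let b := Module.finBasis k V
  refine ⟨?_, ?_⟩
  · refine separatingLeft_baseChange_of_dual b B (fun i => B.flip.dualBasis hB.flip b i) fun i j => ?_
    have := LinearMap.BilinForm.apply_dualBasis_left hB.flip b i j
    rwa [LinearMap.BilinForm.flip_apply] at this
  · exact separatingRight_baseChange_of_dual b B (fun i => B.dualBasis hB b i)
      fun i j => LinearMap.BilinForm.apply_dualBasis_left hB b i j

/-- the form used by Heisenberg groups: for `B` non-degenerate and ALTERNATING-like use, every non-zero `x ∈ A ⊗_k V`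
is detected by some `y`: `Bᴬ(x, y) ≠ 0`. [cite: Varadarajan1984, §3.9 Cor. 3.9.4 (3.9.17)] -/
theorem exists_baseChange_apply_ne_zero {B : BilinForm k V} (hB : B.Nondegenerate) {x : A ⊗[k] V} (hx : x ≠ 0) :
    ∃ y : A ⊗[k] V, B.baseChange A x y ≠ 0 := by
  by_contra h
  push Not at h
  exact hx ((nondegenerate_baseChange_algebra (A := A) hB).1 x h)

end Literature.LinearAlgebra.BaseChange

end
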